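import Mathlib.MeasureTheory.Measure.SeparableMeasure
import Mathlib.MeasureTheory.Function.L2Space
import Literature.Analysis.FunctionSpaces.DiagonalWeakLimits
import Literature.Analysis.FunctionSpaces.TorusSpaceTimeFields
import Literature.Analysis.FunctionSpaces.TorusAxisAverage
import HarnessLib

/-!
# Weak sequential compactness: bounded sequences in a separable Hilbert space, and in
`L^∞(0,T; L²(T^d))` (weak-* limits of space–time fields on the flat torus)

Analysis/FunctionSpaces support file (theorem-only). The "uniformly bounded in `L^∞_t L²_x`,
hence a subsequence converges weak-*" step of every vanishing-viscosity / compactness argument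
on the torus (DiPerna–Majda 1987, §1, (1.4)–(1.5); Bardos–Titi–Wiedemann 2012, proof of Thm. 5:
"since the family … is uniformly bounded in `L^∞_t L²_x`, there exists a subsequence `u^{ν_k}`
which converges weak-* to `u ∈ L^∞_t L²_x`"), isolated as two generic statements:

* `exists_strictMono_tendsto_inner_of_norm_le` — **weak sequential compactness of bounded
  sequences in a separable real Hilbert space**: `‖v n‖ ≤ M` ⇒ along a subsequence
  `⟪v (φ n), z⟫ → ⟪w, z⟫` for every `z`, with `‖w‖ ≤ M` (Brezis 2011, Thm. 3.18 with Prop. 5.1;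
  here: a countable dense set, diagonal extraction
  `Literature.Analysis.FunctionSpaces.exists_strictMono_forall_tendsto_real`, and the weak limit
  from pairings on a dense set
  `Literature.Analysis.FunctionSpaces.exists_mem_tendsto_inner_of_subset_closure_span`).
* `Torus.exists_strictMono_weakLimit_of_lintegral_sq_le` — **weak-* sequential compactness in
  `L^∞(0,T; L²(T^d))`**, function-level form: scalar space–time fields `θ j : ℝ → T^d → ℝ` with
  measurable space–time lifts and `∫ |θ j(t)|² ≤ C` for a.e. `t ∈ (0,T)` have a subsequence and a
  field `W` of the same class (measurable lift, `∫ |W(t)|² ≤ C` for a.e. `t`) with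
  `∫₀ᵀ∫ θ_{φ j} G → ∫₀ᵀ∫ W G` for every square-integrable space–time `G` (weak convergence in
  `L²((0,T) × T^d)`, which on bounded sets of `L^∞_t L²_x` is weak-* convergence; Brezis 2011,
  Cor. 3.30 / Thm. 3.16 for the separable predual `L¹(0,T;L²)`). The `L^∞_t L²_x` bound of the
  limit is obtained by testing against `1_S(t) W` for measurable `S ⊆ (0,T)` and
  `ae_le_of_forall_setLIntegral_le_of_sigmaFinite₀` (weak lower semicontinuity, localised in
  time).

## Mathlib search

Mathlib (this pin) has the Hilbert space `Lp ℝ 2 μ` (`MeasureTheory.L2.innerProductSpace`), its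
second countability for separable measures (`MeasureTheory.Lp.SecondCountableTopology`, needing
`Fact (2 ≠ ∞)` supplied locally), Banach–Alaoglu in the non-sequential form
(`WeakDual.isCompact_closedBall`), but no sequential weak compactness statement for bounded
sequences in Hilbert or reflexive spaces (searched `tendsto_subseq` / `WeakSpace` / `weakly
convergent subsequence`: none); the tree's `DiagonalWeakLimits` supplies the two halves used here.

## References

* H. Brezis, *Functional Analysis, Sobolev Spaces and Partial Differential Equations* (Springer
  2011), Thm. 3.16, Thm. 3.18, Cor. 3.30, Prop. 5.1. [Brezis2011]
* R. J. DiPerna, A. J. Majda, Comm. Math. Phys. 108 (1987), §1, (1.4)–(1.5). [DiPernaMajda1987]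
-/

noncomputable section

open MeasureTheory Filter Topology Set Function TopologicalSpace
open scoped ENNReal NNReal InnerProductSpace RealInnerProductSpace

namespace Literature.Analysis.FunctionSpaces

/-! ## Bounded sequences in a separable Hilbert space -/

section Hilbert

variable {H : Type*} [NormedAddCommGroup H] [InnerProductSpace ℝ H] [CompleteSpace H]
  [SeparableSpace H]

/-- **Weak sequential compactness of bounded sequences in a separable real Hilbert space**
(Brezis 2011, Thm. 3.18; Banach–Alaoglu with a separable predual, Cor. 3.30): if `‖v n‖ ≤ M`
for all `n`, then along some subsequence `⟪v (φ n), z⟫ → ⟪w, z⟫` for every `z`, for some `w`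
with `‖w‖ ≤ M`. Proof: the pairings with the points of a countable dense set are bounded real
sequences, so a diagonal subsequence makes all of them converge
(`exists_strictMono_forall_tendsto_real`); a bounded sequence whose pairings converge on a set
with dense span has a weak limit (`exists_mem_tendsto_inner_of_subset_closure_span`). [cite: Brezis2011, Thm. 3.18] -/
theorem exists_strictMono_tendsto_inner_of_norm_le {v : ℕ → H} {M : ℝ} (hM : ∀ n, ‖v n‖ ≤ M) :
    ∃ φ : ℕ → ℕ, StrictMono φ ∧ ∃ w : H, ‖w‖ ≤ M ∧
      ∀ z, Tendsto (fun n => ⟪v (φ n), z⟫) atTop (𝓝 ⟪w, z⟫) := by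
  obtain ⟨D, hDc, hDd⟩ := exists_countable_dense H
  haveI : Countable D := hDc.to_subtype
  -- diagonal extraction along the countable dense set
  obtain ⟨φ, hφ, hconv⟩ := exists_strictMono_forall_tendsto_real (fun n (d : D) => ⟪v n, (d : H)⟫)
    fun d => ⟨M * ‖(d : H)‖, fun n =>
      (abs_real_inner_le_norm _ _).trans (mul_le_mul_of_nonneg_right (hM n) (norm_nonneg _))⟩
  -- the weak limit from pairings on a dense set
  have hD : ((⊤ : Submodule ℝ H) : Set H) ⊆ closure (Submodule.span ℝ D : Set H) := by
    intro z _
    exact closure_mono Submodule.subset_span (hDd.closure_eq.symm ▸ mem_univ z)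
  obtain ⟨w, -, hwM, hw⟩ := exists_mem_tendsto_inner_of_subset_closure_span ⊤
    (by simp) hD (v := v ∘ φ) (fun _ => Submodule.mem_top)
    (fun n => hM (φ n)) fun d hd => hconv ⟨d, hd⟩
  exact ⟨φ, hφ, w, hwM, hw⟩

end Hilbert

end Literature.Analysis.FunctionSpaces

/-! ## Weak-* sequential compactness in `L^∞(0,T; L²(T^d))` -/

namespace Literature.Analysis.FunctionSpaces

/-- `‖f‖_{L²}² = ∫⁻ ‖f‖ₑ²` (the `p = 2` case of `eLpNorm_eq_lintegral_rpow_enorm_toReal`, with a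
natural-number square). [folklore] -/
theorem eLpNorm_two_pow_two_eq_lintegral {α : Type*} {m : MeasurableSpace α} {μ : Measure α}
    {E : Type*} [NormedAddCommGroup E] (f : α → E) :
    eLpNorm f 2 μ ^ 2 = ∫⁻ x, ‖f x‖ₑ ^ 2 ∂μ := by
  rw [eLpNorm_eq_lintegral_rpow_enorm_toReal two_ne_zero ENNReal.ofNat_ne_top]
  simp only [ENNReal.toReal_ofNat, one_div]
  rw [← ENNReal.rpow_natCast, ← ENNReal.rpow_mul]
  norm_num

/-- `‖f‖_{L²} = (‖f‖_{L²}²)^{1/2}` in `ℝ≥0∞`. [folklore] -/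
theorem eLpNorm_two_eq_pow_two_rpow_half {α : Type*} {m : MeasurableSpace α} {μ : Measure α}
    {E : Type*} [NormedAddCommGroup E] (f : α → E) :
    eLpNorm f 2 μ = (eLpNorm f 2 μ ^ 2) ^ (1 / 2 : ℝ) := by
  rw [← ENNReal.rpow_natCast, ← ENNReal.rpow_mul]
  norm_num

end Literature.Analysis.FunctionSpaces

namespace Literature.Analysis.FunctionSpaces.Torus

variable {d : Type*} [Fintype d]

/-- A space–time field with measurable uncurrying and finite `∫⁻₍₀,T₎∫⁻ |θ|²` is in
`L²((vol|_(0,T)) ⊗ vol)`, with `‖θ‖_{L²}² = ∫⁻₍₀,T₎∫⁻ |θ|²` (Tonelli). [folklore] -/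
theorem memLp_two_uncurry {T : ℝ} {θ : ℝ → UnitAddTorus d → ℝ}
    (hθ : AEStronglyMeasurable (uncurry θ)
      (((volume : Measure ℝ).restrict (Ioo 0 T)).prod (volume : Measure (UnitAddTorus d))))
    (hfin : ∫⁻ t in Ioo 0 T, ∫⁻ x, ‖θ t x‖ₑ ^ 2 < ∞) :
    MemLp (uncurry θ) 2 (((volume : Measure ℝ).restrict (Ioo 0 T)).prod (volume : Measure (UnitAddTorus d))) ∧
      eLpNorm (uncurry θ) 2 (((volume : Measure ℝ).restrict (Ioo 0 T)).prod (volume : Measure (UnitAddTorus d))) ^ 2 =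
        ∫⁻ t in Ioo 0 T, ∫⁻ x, ‖θ t x‖ₑ ^ 2 := by
  have hsq : eLpNorm (uncurry θ) 2
      (((volume : Measure ℝ).restrict (Ioo 0 T)).prod (volume : Measure (UnitAddTorus d))) ^ 2 =
      ∫⁻ t in Ioo 0 T, ∫⁻ x, ‖θ t x‖ₑ ^ 2 := by
    rw [eLpNorm_two_pow_two_eq_lintegral, lintegral_prod _ (hθ.aemeasurable.enorm.pow_const 2)]
    rfl
  refine ⟨⟨hθ, ?_⟩, hsq⟩
  rw [eLpNorm_two_eq_pow_two_rpow_half, hsq]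
  exact ENNReal.rpow_lt_top_of_nonneg (by norm_num) hfin.ne

/-- The `L²((vol|_(0,T)) ⊗ vol)` pairing of two space–time fields is the iterated integral
`∫_{(0,T)} ∫ θ G` (Fubini; the product of two `L²` functions is integrable). [folklore] -/
theorem inner_toLp_uncurry_eq {T : ℝ} {θ G : ℝ → UnitAddTorus d → ℝ}
    (hθ : MemLp (uncurry θ) 2 (((volume : Measure ℝ).restrict (Ioo 0 T)).prod (volume : Measure (UnitAddTorus d))))
    (hG : MemLp (uncurry G) 2 (((volume : Measure ℝ).restrict (Ioo 0 T)).prod (volume : Measure (UnitAddTorus d)))) :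
    ⟪hθ.toLp (uncurry θ), hG.toLp (uncurry G)⟫ = ∫ t in Ioo 0 T, ∫ x, θ t x * G t x := by
  have hint : Integrable (fun p : ℝ × UnitAddTorus d => θ p.1 p.2 * G p.1 p.2)
      (((volume : Measure ℝ).restrict (Ioo 0 T)).prod (volume : Measure (UnitAddTorus d))) :=
    hθ.integrable_mul hG
  rw [L2.inner_def, ← integral_prod _ hint]
  refine integral_congr_ae ?_
  filter_upwards [hθ.coeFn_toLp, hG.coeFn_toLp] with p hp hq
  rw [hp, hq, real_inner_comm, RCLike.inner_apply, conj_trivial]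
  rfl

/-- **Weak-* sequential compactness in `L^∞(0,T; L²(T^d))`, function-level form**
(Banach–Alaoglu for the separable predual `L¹(0,T; L²)`, Brezis 2011, Cor. 3.30 / Thm. 3.16;
the form used by DiPerna–Majda 1987, §1, (1.4)–(1.5) and Bardos–Titi–Wiedemann 2012, proof of
Thm. 5). Let `θ j : ℝ → T^d → ℝ` be scalar space–time fields with a.e. strongly measurable
space–time lifts on `(0,T) × ℝ^d` and `∫ |θ j (t)|² ≤ C` for a.e. `t ∈ (0,T)`, uniformly in `j`.
Then there are a subsequence `φ` and a field `W` of the same class — measurable lift,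
`∫ |W(t)|² ≤ C` for a.e. `t ∈ (0,T)` — such that `∫₀ᵀ∫ θ (φ j) G → ∫₀ᵀ∫ W G` for every
space–time `G` with measurable lift and `∫₀ᵀ∫ |G|² < ∞`. Proof: the `uncurry (θ j)` form a
bounded sequence in the separable Hilbert space `L²((vol|_(0,T)) ⊗ vol)`
(`exists_strictMono_tendsto_inner_of_norm_le`); the weak limit `w`, read as a function, is `W`;
pairings are iterated integrals (`inner_toLp_uncurry_eq`); the slicewise bound follows by
testing against `1_S(t) W` and Cauchy–Schwarz, for every measurable `S`, and
`ae_le_of_forall_setLIntegral_le_of_sigmaFinite₀`. [cite: Brezis2011, Cor. 3.30] -/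
theorem exists_strictMono_weakLimit_of_lintegral_sq_le {T : ℝ} {C : ℝ≥0}
    {θ : ℕ → ℝ → UnitAddTorus d → ℝ}
    (hm : ∀ j, AEStronglyMeasurable (stLift (θ j)) (volume.restrict (Ioo 0 T ×ˢ univ)))
    (hb : ∀ j, ∀ᵐ t ∂(volume.restrict (Ioo 0 T)), ∫⁻ x, ‖θ j t x‖ₑ ^ 2 ≤ C) :
    ∃ φ : ℕ → ℕ, StrictMono φ ∧ ∃ W : ℝ → UnitAddTorus d → ℝ,
      AEStronglyMeasurable (stLift W) (volume.restrict (Ioo 0 T ×ˢ univ)) ∧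
      (∀ᵐ t ∂(volume.restrict (Ioo 0 T)), ∫⁻ x, ‖W t x‖ₑ ^ 2 ≤ C) ∧
      ∀ G : ℝ → UnitAddTorus d → ℝ,
        AEStronglyMeasurable (stLift G) (volume.restrict (Ioo 0 T ×ˢ univ)) →
        ∫⁻ t in Ioo 0 T, ∫⁻ x, ‖G t x‖ₑ ^ 2 < ∞ →
        Tendsto (fun j => ∫ t in Ioo 0 T, ∫ x, θ (φ j) t x * G t x) atTop
          (𝓝 (∫ t in Ioo 0 T, ∫ x, W t x * G t x)) := by
  haveI : Fact ((2 : ℝ≥0∞) ≠ ∞) := ⟨ENNReal.ofNat_ne_top⟩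
  haveI : SeparableSpace (Lp ℝ 2
      (((volume : Measure ℝ).restrict (Ioo 0 T)).prod (volume : Measure (UnitAddTorus d)))) :=
    inferInstance
  set μ : Measure (ℝ × UnitAddTorus d) :=
    ((volume : Measure ℝ).restrict (Ioo 0 T)).prod (volume : Measure (UnitAddTorus d)) with hμ
  -- the fields as a bounded sequence in `L²(μ)`
  have hvol : volume (Ioo (0 : ℝ) T) < ∞ := measure_Ioo_lt_top
  set B : ℝ≥0∞ := C * volume (Ioo (0 : ℝ) T) with hB
  have hBfin : B < ∞ := ENNReal.mul_lt_top ENNReal.coe_lt_top hvol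
  have hθm : ∀ j, AEStronglyMeasurable (uncurry (θ j)) μ := fun j =>
    aestronglyMeasurable_uncurry_of_stLift_prod (hm j)
  have hθ2 : ∀ j, ∫⁻ t in Ioo 0 T, ∫⁻ x, ‖θ j t x‖ₑ ^ 2 ≤ B := fun j =>
    calc ∫⁻ t in Ioo 0 T, ∫⁻ x, ‖θ j t x‖ₑ ^ 2 ≤ ∫⁻ _ in Ioo (0 : ℝ) T, (C : ℝ≥0∞) :=
          lintegral_mono_ae (hb j)
      _ = B := by rw [lintegral_const, Measure.restrict_apply_univ]
  have hθL : ∀ j, MemLp (uncurry (θ j)) 2 μ ∧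
      eLpNorm (uncurry (θ j)) 2 μ ^ 2 = ∫⁻ t in Ioo 0 T, ∫⁻ x, ‖θ j t x‖ₑ ^ 2 := fun j =>
    memLp_two_uncurry (hθm j) ((hθ2 j).trans_lt hBfin)
  set M : ℝ := (B ^ (1 / 2 : ℝ)).toReal with hM
  set v : ℕ → Lp ℝ 2 μ := fun j => (hθL j).1.toLp (uncurry (θ j)) with hv
  have hvM : ∀ j, ‖v j‖ ≤ M := by
    intro j
    rw [hv, Lp.norm_toLp, hM]
    refine ENNReal.toReal_mono (ENNReal.rpow_ne_top_of_nonneg (by norm_num) hBfin.ne) ?_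
    rw [eLpNorm_two_eq_pow_two_rpow_half, (hθL j).2]
    exact ENNReal.rpow_le_rpow (hθ2 j) (by norm_num)
  -- weak limit in the separable Hilbert space `L²(μ)`
  obtain ⟨φ, hφ, w, -, hw⟩ := exists_strictMono_tendsto_inner_of_norm_le hvM
  -- the limit as a field
  set W : ℝ → UnitAddTorus d → ℝ := fun t x => (w : ℝ × UnitAddTorus d → ℝ) (t, x) with hWdef
  have hWunc : uncurry W = (w : ℝ × UnitAddTorus d → ℝ) := rfl
  have hWm : AEStronglyMeasurable (uncurry W) μ := hWunc ▸ (Lp.aestronglyMeasurable w)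
  have hWL : MemLp (uncurry W) 2 μ := hWunc ▸ Lp.memLp w
  have hWto : hWL.toLp (uncurry W) = w := Lp.toLp_coeFn w (Lp.memLp w)
  -- pairings are iterated integrals
  have hpair : ∀ G : ℝ → UnitAddTorus d → ℝ, ∀ hG : MemLp (uncurry G) 2 μ,
      Tendsto (fun j => ∫ t in Ioo 0 T, ∫ x, θ (φ j) t x * G t x) atTop
        (𝓝 (∫ t in Ioo 0 T, ∫ x, W t x * G t x)) := by
    intro G hG
    have h := hw (hG.toLp (uncurry G))
    have h1 : ∀ j, ⟪v (φ j), hG.toLp (uncurry G)⟫ = ∫ t in Ioo 0 T, ∫ x, θ (φ j) t x * G t x :=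
      fun j => inner_toLp_uncurry_eq (hθL (φ j)).1 hG
    have h2 : ⟪w, hG.toLp (uncurry G)⟫ = ∫ t in Ioo 0 T, ∫ x, W t x * G t x := by
      rw [← hWto]
      exact inner_toLp_uncurry_eq hWL hG
    simp_rw [h1, h2] at h
    exact h
  refine ⟨φ, hφ, W, aestronglyMeasurable_stLift_of_uncurry (S := Ioo 0 T) hWm, ?_,
    fun G hGm hG2 => hpair G
      (memLp_two_uncurry (aestronglyMeasurable_uncurry_of_stLift_prod hGm) hG2).1⟩
  -- the `L^∞_t L²_x` bound of the limit, by testing against `1_S W` for measurable `S`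
  set f : ℝ → ℝ≥0∞ := fun t => ∫⁻ x, ‖W t x‖ₑ ^ 2 with hf
  have hfm : AEMeasurable f (volume.restrict (Ioo 0 T)) :=
    (hWm.aemeasurable.enorm.pow_const 2).lintegral_prod_right'
  change ∀ᵐ t ∂(volume.restrict (Ioo 0 T)), f t ≤ C
  refine ae_le_of_forall_setLIntegral_le_of_sigmaFinite₀ hfm fun S hS _ => ?_
  rw [lintegral_const, Measure.restrict_apply_univ, Measure.restrict_apply hS]
  set K : ℝ≥0∞ := C * volume (S ∩ Ioo (0 : ℝ) T) with hK
  have hKfin : K < ∞ :=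
    ENNReal.mul_lt_top ENNReal.coe_lt_top ((measure_mono inter_subset_right).trans_lt hvol)
  have hSm : MeasurableSet (S ×ˢ (univ : Set (UnitAddTorus d))) := hS.prod MeasurableSet.univ
  have hrestr : μ.restrict (S ×ˢ univ) =
      (((volume : Measure ℝ).restrict (Ioo 0 T)).restrict S).prod (volume : Measure (UnitAddTorus d)) := by
    rw [hμ, ← Measure.prod_restrict, Measure.restrict_univ]
  -- Tonelli on `S × T^d`
  have htonelli : ∀ {g : ℝ → UnitAddTorus d → ℝ}, AEStronglyMeasurable (uncurry g) μ →
      eLpNorm ((S ×ˢ univ).indicator (uncurry g)) 2 μ ^ 2 =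
        ∫⁻ t in S, (∫⁻ x, ‖g t x‖ₑ ^ 2) ∂(volume.restrict (Ioo 0 T)) := by
    intro g hg
    have hg' : AEStronglyMeasurable (uncurry g) (μ.restrict (S ×ˢ univ)) :=
      hg.mono_measure Measure.restrict_le_self
    rw [hrestr] at hg'
    rw [eLpNorm_indicator_eq_eLpNorm_restrict hSm, eLpNorm_two_pow_two_eq_lintegral, hrestr,
      lintegral_prod _ (hg'.aemeasurable.enorm.pow_const 2)]
    rfl
  -- `‖1_S W‖² = ∫_S f` and `‖1_S θ_j‖² ≤ K`
  set WS : ℝ × UnitAddTorus d → ℝ := (S ×ˢ univ).indicator (uncurry W) with hWS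
  have hWSL : MemLp WS 2 μ := hWL.indicator hSm
  have hWS_sq : eLpNorm WS 2 μ ^ 2 = ∫⁻ t in S, f t ∂(volume.restrict (Ioo 0 T)) := htonelli hWm
  have hθSL : ∀ j, MemLp ((S ×ˢ univ).indicator (uncurry (θ j))) 2 μ := fun j =>
    (hθL j).1.indicator hSm
  have hθS_sq : ∀ j, eLpNorm ((S ×ˢ univ).indicator (uncurry (θ j))) 2 μ ^ 2 ≤ K := by
    intro j
    rw [htonelli (hθm j)]
    calc ∫⁻ t in S, (∫⁻ x, ‖θ j t x‖ₑ ^ 2) ∂(volume.restrict (Ioo 0 T))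
        ≤ ∫⁻ _ in S, (C : ℝ≥0∞) ∂(volume.restrict (Ioo 0 T)) :=
          lintegral_mono_ae (ae_restrict_of_ae (hb j))
      _ = K := by rw [lintegral_const, Measure.restrict_apply_univ, Measure.restrict_apply hS]
  -- the pairing `⟪v (φ j), 1_S W⟫ = ⟪1_S θ_(φ j), 1_S W⟫ ≤ √K ‖1_S W‖`
  set z : Lp ℝ 2 μ := hWSL.toLp WS with hz
  have hinner_eq : ∀ j, ⟪v (φ j), z⟫ = ⟪(hθSL (φ j)).toLp _, z⟫ := by
    intro j
    rw [hv, hz, L2.inner_def, L2.inner_def]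
    refine integral_congr_ae ?_
    filter_upwards [(hθL (φ j)).1.coeFn_toLp, (hθSL (φ j)).coeFn_toLp, hWSL.coeFn_toLp]
      with p hp hq hr
    rw [hp, hq, hr, hWS]
    by_cases hpS : p ∈ S ×ˢ (univ : Set (UnitAddTorus d))
    · rw [indicator_of_mem hpS, indicator_of_mem hpS]
    · rw [indicator_of_notMem hpS, indicator_of_notMem hpS, inner_zero_right, inner_zero_right]
  have hbound : ∀ j, ⟪v (φ j), z⟫ ≤ (K ^ (1 / 2 : ℝ)).toReal * ‖z‖ := by
    intro j
    rw [hinner_eq j]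
    refine (real_inner_le_norm _ _).trans (mul_le_mul_of_nonneg_right ?_ (norm_nonneg _))
    rw [Lp.norm_toLp]
    refine ENNReal.toReal_mono (ENNReal.rpow_ne_top_of_nonneg (by norm_num) hKfin.ne) ?_
    rw [eLpNorm_two_eq_pow_two_rpow_half]
    exact ENNReal.rpow_le_rpow (hθS_sq (φ j)) (by norm_num)
  -- in the limit: `‖z‖² = ⟪w, z⟫ ≤ √K ‖z‖`, so `‖z‖ ≤ √K`
  have hwz : ⟪w, z⟫ = ‖z‖ ^ 2 := by
    rw [← hWto, hz, ← real_inner_self_eq_norm_sq, L2.inner_def, L2.inner_def]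
    refine integral_congr_ae ?_
    filter_upwards [hWL.coeFn_toLp, hWSL.coeFn_toLp] with p hp hq
    rw [hp, hq, hWS]
    by_cases hpS : p ∈ S ×ˢ (univ : Set (UnitAddTorus d))
    · rw [indicator_of_mem hpS]
    · rw [indicator_of_notMem hpS, inner_zero_right, inner_zero_right]
  have hlim : ‖z‖ ^ 2 ≤ (K ^ (1 / 2 : ℝ)).toReal * ‖z‖ := by
    rw [← hwz]
    exact le_of_tendsto (hw z) (Eventually.of_forall hbound)
  have hz_le : ‖z‖ ≤ (K ^ (1 / 2 : ℝ)).toReal := by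
    by_cases h0 : ‖z‖ = 0
    · rw [h0]; exact ENNReal.toReal_nonneg
    · exact le_of_mul_le_mul_right (by nlinarith [hlim])
        (lt_of_le_of_ne (norm_nonneg z) (Ne.symm h0))
  -- back to `∫_S f ≤ K`
  have hzn : ‖z‖ₑ = eLpNorm WS 2 μ := by rw [hz, Lp.enorm_toLp]
  calc ∫⁻ t in S, f t ∂(volume.restrict (Ioo 0 T)) = eLpNorm WS 2 μ ^ 2 := hWS_sq.symm
    _ = ‖z‖ₑ ^ 2 := by rw [hzn]
    _ ≤ (K ^ (1 / 2 : ℝ)) ^ 2 := by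
        gcongr
        rw [← ofReal_norm, ← ENNReal.ofReal_toReal (ENNReal.rpow_ne_top_of_nonneg (by norm_num) hKfin.ne)]
        exact ENNReal.ofReal_le_ofReal hz_le
    _ = K := by rw [← ENNReal.rpow_natCast, ← ENNReal.rpow_mul]; norm_num

end Literature.Analysis.FunctionSpaces.Torus

end
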